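/-
Copyright: statement-level skeleton of a published paper (lit-balaban cell, Phase-2 proof seat p37 gen 106). No claims beyond
what the kernel checks below.
-/
import Literature.MathematicalPhysics.QuantumFieldTheory.Balaban1983to89.B3Cor23Concrete

/-!
# B3 — T. Bałaban, *(Higgs)₂,₃ quantum fields in a finite volume. III. Renormalization*, CMP **88** (1983) 411–445
[Balaban1983Higgs3] — p. 415 [PDF 5] (1.17) and p. 416 [PDF 6] (1.21): the LEGS and the LINE DATA of two vertex families placed
side by side, with ONE NEW LINE between a chosen leg of each — the plumbing under the glue constructor `B3GraphGlue.glue` on the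
concrete graph model `B3Cor23Concrete.Graph` (p18)

statement-level skeleton of published theorems with citation tags; proofs where landed; nothing here is a claim about
the Yang–Mills mass gap

PDF held: `paper:balaban1983-higgs-2-3-quantum-fields-finite-volume` (journal page = PDF page + 410); pp. 414–416 read in the
text layer (`p0004.txt`–`p0006.txt` of `lit read`) and on the ×2 renders `run/shared/lean/pub/pub-balaban/b2b-balaban-ref1/pages/
1983-cmp88-higgs23-III/1983-cmp88-higgs23-III-p004, p005, p006-x2.png`.

CITATION HEADER (lean-in-tree rule).  lit-balaban TYPED SKELETON (HOME `run/shared/lean/pub/lit-balaban/`), PHASE 2, seat p37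
gen 106 (unit `lit-balaban-p37`; TAKING lines HOME/STATUS.md 2026-08-23T10:15:46Z and the FILE F addendum), first half of FILE F
of BRICK 3 of the owner r15's HQ25 programme for row **B3.Eq1.19-1.22** of `HOME/lit-balaban-r15/ROWS-B3.md` (fold owner r15,
referee ref-4; lead g12 HEAD WORD Q25 2026-08-23T08:24:18Z: bricks WELCOME as located members, zero head weight).  Consumer: the
sibling `B3GraphGlue` (the glued GRAPH, connectedness, the new line separates) and `B3OnePIChainGlue` (chains).  REUSED BY NAME,
nothing re-declared: p18's `B3Cor23Concrete.Leg` and the vertex catalogue `B3Prop1.VertexKind` (`scalarLegs`, `vectorLegs`).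

THE PRINTED TEXT (verbatim).  p. 414: *"… they are divided into pairs and each pair is replaced by the corresponding
propagator."*  p. 415: *"… every internal line has a vertex at each endpoint. The construction of graphs is otherwise
arbitrary."*  p. 416 (1.21): *"G^ε = Σ_{n=0}^∞ C₀^ε[(−δm² + Σ^ε + …)C₀^ε]ⁿ"* — consecutive insertions joined by one C₀^ε-line.

KIND «(ours)» (G.5-54): the constructions below are OUR plumbing ∕ dictionary on p18's model — print provenance is claimed only for the
sentences quoted above; each declaration's cite tag locates the printed notion it serves (legs (1.17) p. 415, lines ∕ chains (1.21) p. 416).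
WHAT IS TYPED / PROVED (definitions with bodies + kernel theorems; no `Prop` fact, no `sorry`; standard axioms).
§1 LEGS OF A JUXTAPOSITION.  For vertex families `k₁ : Fin n₁ → VertexKind`, `k₂ : Fin n₂ → VertexKind` placed side by side as
`Fin.append k₁ k₂ : Fin (n₁ + n₂) → VertexKind`: `fibreCast` (transport of a leg fibre along an equality of vertex kinds, with
`fibreCast_self`, `fibreCast_trans`, `isLeft_fibreCast`, `fibreCast_injective`), the embeddings `legL`/`legR` of the legs of
either family, the splitting `unglue`, and the equivalence **`legEquiv : Leg k₁ ⊕ Leg k₂ ≃ Leg (Fin.append k₁ k₂)`** (`unglue_legL`,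
`unglue_legR`, `elim_unglue`, `legEquiv_inl`/`_inr`/`_symm_apply`, `fst_legL`, `fst_legR`, `isLeft_legL`, `isLeft_legR`,
`legL_injective`, `legR_injective`, `legL_ne_legR`, `exists_legL_or_legR`, `val_fst_legL_lt`, `le_val_fst_legR`).
§2 THE GLUED LINE DATA.  `jointOther o₁ o₂ a b` on `Leg k₁ ⊕ Leg k₂` (the old lines `o₁`, `o₂` of both sides and ONE NEW LINE
a—b) and its transport `glueOther o₁ o₂ a b` to `Leg (Fin.append k₁ k₂)`; computation rules `jointOther_inl_self`/`_inr_self`/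
`_inl_of_ne`/`_inr_of_ne`, `glueOther_legEquiv`, `glueOther_legL_self` (the new line), `glueOther_legR_self`,
`glueOther_legL_of_ne`, `glueOther_legR_of_ne` (old lines kept), `glueOther_eq_some_iff`; the FIELD LAWS of p18's `Graph`
for the glued data — `jointOther_ne`/`glueOther_ne` (two distinct endpoints), `jointOther_symm`/`glueOther_symm` ("the other
endpoint" symmetric; uses that `a`, `b` were external), `jointOther_isLeft`/`glueOther_isLeft` (lines join legs of one species,
given `a.2.isLeft = b.2.isLeft`).
HONEST SCOPE.  Plumbing only (no graph is formed here: `B3GraphGlue.glue`); nothing analytic.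
-/

namespace Literature.MathematicalPhysics.QuantumFieldTheory.Balaban1983to89.B3GraphGlueLegs

open B3Prop1 B3Cor23Concrete

/-! ## §1 Legs of a juxtaposition of two vertex families -/

section Legs

/-- Transport of a leg fibre `Fin v.scalarLegs ⊕ Fin v.vectorLegs` along an equality of vertex kinds `v = w` (a re-indexing
`Fin.cast` on each summand; values and species are kept). [cite: Balaban1983Higgs3, (1.17) p.415] -/
def fibreCast {v w : VertexKind} (h : v = w) :
    Fin v.scalarLegs ⊕ Fin v.vectorLegs → Fin w.scalarLegs ⊕ Fin w.vectorLegs :=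
  Sum.map (Fin.cast (by rw [h])) (Fin.cast (by rw [h]))

/-- kernel: transport along `v = v` is the identity. [cite: Balaban1983Higgs3, (1.17) p.415] -/
@[simp] theorem fibreCast_self {v : VertexKind} (h : v = v) (s : Fin v.scalarLegs ⊕ Fin v.vectorLegs) : fibreCast h s = s := by
  cases s <;> simp [fibreCast]

/-- kernel: transports compose. [cite: Balaban1983Higgs3, (1.17) p.415] -/
@[simp] theorem fibreCast_trans {u v w : VertexKind} (h : u = v) (h' : v = w) (s : Fin u.scalarLegs ⊕ Fin u.vectorLegs) :
    fibreCast h' (fibreCast h s) = fibreCast (h.trans h') s := by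
  subst h; subst h'; simp

/-- kernel: transport keeps the species of a leg (φ′ = `inl` / A′ = `inr`). [cite: Balaban1983Higgs3, (1.17) p.415] -/
@[simp] theorem isLeft_fibreCast {v w : VertexKind} (h : v = w) (s : Fin v.scalarLegs ⊕ Fin v.vectorLegs) :
    (fibreCast h s).isLeft = s.isLeft := by
  cases s <;> simp [fibreCast]

/-- kernel: transport is injective. [cite: Balaban1983Higgs3, (1.17) p.415] -/
theorem fibreCast_injective {v w : VertexKind} (h : v = w) : Function.Injective (fibreCast h) := by
  subst h; intro s t hst; simpa using hst

variable {n₁ n₂ : ℕ} (k₁ : Fin n₁ → VertexKind) (k₂ : Fin n₂ → VertexKind)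

/-- A leg of the first family, seen as a leg of the juxtaposed family `Fin.append k₁ k₂` (its vertex `i` becomes `Fin.castAdd n₂ i`).
[cite: Balaban1983Higgs3, (1.17) p.415] -/
def legL (x : Leg k₁) : Leg (Fin.append k₁ k₂) :=
  ⟨Fin.castAdd n₂ x.1, fibreCast (Fin.append_left k₁ k₂ x.1).symm x.2⟩

/-- A leg of the second family, seen as a leg of the juxtaposed family (its vertex `j` becomes `Fin.natAdd n₁ j`).
[cite: Balaban1983Higgs3, (1.17) p.415] -/
def legR (y : Leg k₂) : Leg (Fin.append k₁ k₂) :=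
  ⟨Fin.natAdd n₁ y.1, fibreCast (Fin.append_right k₁ k₂ y.1).symm y.2⟩

/-- Splitting a leg of the juxtaposed family according to the side of its vertex. [cite: Balaban1983Higgs3, (1.17) p.415] -/
def unglue (z : Leg (Fin.append k₁ k₂)) : Leg k₁ ⊕ Leg k₂ :=
  Fin.addCases
    (motive := fun v => (Fin (Fin.append k₁ k₂ v).scalarLegs ⊕ Fin (Fin.append k₁ k₂ v).vectorLegs) → Leg k₁ ⊕ Leg k₂)
    (fun i s => Sum.inl ⟨i, fibreCast (Fin.append_left k₁ k₂ i) s⟩)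
    (fun j s => Sum.inr ⟨j, fibreCast (Fin.append_right k₁ k₂ j) s⟩) z.1 z.2

/-- kernel: splitting recovers a leg of the first family. [cite: Balaban1983Higgs3, (1.17) p.415] -/
@[simp] theorem unglue_legL (x : Leg k₁) : unglue k₁ k₂ (legL k₁ k₂ x) = Sum.inl x := by
  obtain ⟨i, s⟩ := x
  simp [unglue, legL, Fin.addCases_left]

/-- kernel: splitting recovers a leg of the second family. [cite: Balaban1983Higgs3, (1.17) p.415] -/
@[simp] theorem unglue_legR (y : Leg k₂) : unglue k₁ k₂ (legR k₁ k₂ y) = Sum.inr y := by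
  obtain ⟨j, s⟩ := y
  simp [unglue, legR, Fin.addCases_right]

/-- kernel: every leg of the juxtaposed family comes from exactly one side. [cite: Balaban1983Higgs3, (1.17) p.415] -/
theorem elim_unglue (z : Leg (Fin.append k₁ k₂)) : Sum.elim (legL k₁ k₂) (legR k₁ k₂) (unglue k₁ k₂ z) = z := by
  obtain ⟨v, s⟩ := z
  induction v using Fin.addCases with
  | left i => simp [unglue, Fin.addCases_left, legL]
  | right j => simp [unglue, Fin.addCases_right, legR]

/-- **the legs of the juxtaposed family are the legs of the two families**: `Leg k₁ ⊕ Leg k₂ ≃ Leg (Fin.append k₁ k₂)`.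
[cite: Balaban1983Higgs3, (1.17) p.415] -/
def legEquiv : Leg k₁ ⊕ Leg k₂ ≃ Leg (Fin.append k₁ k₂) where
  toFun := Sum.elim (legL k₁ k₂) (legR k₁ k₂)
  invFun := unglue k₁ k₂
  left_inv := by rintro (x | y) <;> simp
  right_inv := elim_unglue k₁ k₂

/-- kernel: `legEquiv` on the first summand is `legL`. [cite: Balaban1983Higgs3, (1.17) p.415] -/
@[simp] theorem legEquiv_inl (x : Leg k₁) : legEquiv k₁ k₂ (Sum.inl x) = legL k₁ k₂ x := rfl

/-- kernel: `legEquiv` on the second summand is `legR`. [cite: Balaban1983Higgs3, (1.17) p.415] -/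
@[simp] theorem legEquiv_inr (y : Leg k₂) : legEquiv k₁ k₂ (Sum.inr y) = legR k₁ k₂ y := rfl

/-- kernel: the inverse of `legEquiv` is the splitting `unglue`. [cite: Balaban1983Higgs3, (1.17) p.415] -/
@[simp] theorem legEquiv_symm_apply (z : Leg (Fin.append k₁ k₂)) : (legEquiv k₁ k₂).symm z = unglue k₁ k₂ z := rfl

/-- kernel: the vertex of an embedded left leg. [cite: Balaban1983Higgs3, (1.17) p.415] -/
@[simp] theorem fst_legL (x : Leg k₁) : (legL k₁ k₂ x).1 = Fin.castAdd n₂ x.1 := rfl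

/-- kernel: the vertex of an embedded right leg. [cite: Balaban1983Higgs3, (1.17) p.415] -/
@[simp] theorem fst_legR (y : Leg k₂) : (legR k₁ k₂ y).1 = Fin.natAdd n₁ y.1 := rfl

/-- kernel: the embedding keeps the species of a leg. [cite: Balaban1983Higgs3, (1.17) p.415] -/
@[simp] theorem isLeft_legL (x : Leg k₁) : (legL k₁ k₂ x).2.isLeft = x.2.isLeft := by
  simp [legL]

/-- kernel: the embedding keeps the species of a leg. [cite: Balaban1983Higgs3, (1.17) p.415] -/
@[simp] theorem isLeft_legR (y : Leg k₂) : (legR k₁ k₂ y).2.isLeft = y.2.isLeft := by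
  simp [legR]

/-- kernel: `legL` is injective. [cite: Balaban1983Higgs3, (1.17) p.415] -/
theorem legL_injective : Function.Injective (legL k₁ k₂) := fun x x' h => by
  simpa using congrArg (unglue k₁ k₂) h

/-- kernel: `legR` is injective. [cite: Balaban1983Higgs3, (1.17) p.415] -/
theorem legR_injective : Function.Injective (legR k₁ k₂) := fun y y' h => by
  simpa using congrArg (unglue k₁ k₂) h

/-- kernel: a left leg is never a right leg. [cite: Balaban1983Higgs3, (1.17) p.415] -/
theorem legL_ne_legR (x : Leg k₁) (y : Leg k₂) : legL k₁ k₂ x ≠ legR k₁ k₂ y := fun h => by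
  simpa using congrArg (unglue k₁ k₂) h

/-- kernel: every leg of the juxtaposed family is a left leg or a right leg. [cite: Balaban1983Higgs3, (1.17) p.415] -/
theorem exists_legL_or_legR (z : Leg (Fin.append k₁ k₂)) : (∃ x, z = legL k₁ k₂ x) ∨ ∃ y, z = legR k₁ k₂ y := by
  have h := elim_unglue k₁ k₂ z
  cases hu : unglue k₁ k₂ z with
  | inl x => exact Or.inl ⟨x, by rw [hu] at h; exact h.symm⟩
  | inr y => exact Or.inr ⟨y, by rw [hu] at h; exact h.symm⟩

/-- kernel: the vertex of a left leg lies in the first block (`< n₁`). [cite: Balaban1983Higgs3, (1.17) p.415] -/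
theorem val_fst_legL_lt (x : Leg k₁) : ((legL k₁ k₂ x).1 : ℕ) < n₁ := by
  simp

/-- kernel: the vertex of a right leg lies in the second block (`≥ n₁`). [cite: Balaban1983Higgs3, (1.17) p.415] -/
theorem le_val_fst_legR (y : Leg k₂) : n₁ ≤ ((legR k₁ k₂ y).1 : ℕ) := by
  simp

end Legs

/-! ## §2 The glued line data: the old lines of both sides and one new line -/

section LineData

variable {n₁ n₂ : ℕ} {k₁ : Fin n₁ → VertexKind} {k₂ : Fin n₂ → VertexKind}
  (o₁ : Leg k₁ → Option (Leg k₁)) (o₂ : Leg k₂ → Option (Leg k₂)) (a : Leg k₁) (b : Leg k₂)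

/-- The glued "other endpoint" map on `Leg k₁ ⊕ Leg k₂`: the lines of `o₁` and of `o₂` are kept, and ONE NEW LINE joins the leg
`a` of the first side to the leg `b` of the second (p. 414: a pair of legs *"replaced by the corresponding propagator"*).
[cite: Balaban1983Higgs3, (1.21) p.416] -/
def jointOther : Leg k₁ ⊕ Leg k₂ → Option (Leg k₁ ⊕ Leg k₂)
  | .inl x => if x = a then some (.inr b) else (o₁ x).map Sum.inl
  | .inr y => if y = b then some (.inl a) else (o₂ y).map Sum.inr

/-- The glued "other endpoint" map on the legs of the juxtaposed family (transport of `jointOther` along `legEquiv`).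
[cite: Balaban1983Higgs3, (1.21) p.416] -/
def glueOther : Leg (Fin.append k₁ k₂) → Option (Leg (Fin.append k₁ k₂)) :=
  fun z => (jointOther o₁ o₂ a b ((legEquiv k₁ k₂).symm z)).map (legEquiv k₁ k₂)

variable {o₁ o₂ a b}

/-- kernel: the new line, read from the first side. [cite: Balaban1983Higgs3, (1.21) p.416] -/
@[simp] theorem jointOther_inl_self : jointOther o₁ o₂ a b (.inl a) = some (.inr b) := by
  simp [jointOther]

/-- kernel: the new line, read from the second side. [cite: Balaban1983Higgs3, (1.21) p.416] -/
@[simp] theorem jointOther_inr_self : jointOther o₁ o₂ a b (.inr b) = some (.inl a) := by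
  simp [jointOther]

/-- kernel: the old lines of the first side are kept. [cite: Balaban1983Higgs3, (1.21) p.416] -/
theorem jointOther_inl_of_ne {x : Leg k₁} (hx : x ≠ a) : jointOther o₁ o₂ a b (.inl x) = (o₁ x).map Sum.inl := by
  simp [jointOther, hx]

/-- kernel: the old lines of the second side are kept. [cite: Balaban1983Higgs3, (1.21) p.416] -/
theorem jointOther_inr_of_ne {y : Leg k₂} (hy : y ≠ b) : jointOther o₁ o₂ a b (.inr y) = (o₂ y).map Sum.inr := by
  simp [jointOther, hy]

/-- kernel: `glueOther` on an embedded leg is `jointOther` transported. [cite: Balaban1983Higgs3, (1.21) p.416] -/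
theorem glueOther_legEquiv (u : Leg k₁ ⊕ Leg k₂) :
    glueOther o₁ o₂ a b (legEquiv k₁ k₂ u) = (jointOther o₁ o₂ a b u).map (legEquiv k₁ k₂) := by
  simp [glueOther]

/-- kernel: the new line joins `legL a` to `legR b`. [cite: Balaban1983Higgs3, (1.21) p.416] -/
@[simp] theorem glueOther_legL_self : glueOther o₁ o₂ a b (legL k₁ k₂ a) = some (legR k₁ k₂ b) := by
  rw [← legEquiv_inl, glueOther_legEquiv]; simp

/-- kernel: … and `legR b` to `legL a`. [cite: Balaban1983Higgs3, (1.21) p.416] -/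
@[simp] theorem glueOther_legR_self : glueOther o₁ o₂ a b (legR k₁ k₂ b) = some (legL k₁ k₂ a) := by
  rw [← legEquiv_inr, glueOther_legEquiv]; simp

/-- kernel: an old leg of the first side keeps its line (or stays external). [cite: Balaban1983Higgs3, (1.21) p.416] -/
theorem glueOther_legL_of_ne {x : Leg k₁} (hx : x ≠ a) :
    glueOther o₁ o₂ a b (legL k₁ k₂ x) = (o₁ x).map (legL k₁ k₂) := by
  rw [← legEquiv_inl, glueOther_legEquiv, jointOther_inl_of_ne hx]
  cases o₁ x <;> simp

/-- kernel: an old leg of the second side keeps its line (or stays external). [cite: Balaban1983Higgs3, (1.21) p.416] -/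
theorem glueOther_legR_of_ne {y : Leg k₂} (hy : y ≠ b) :
    glueOther o₁ o₂ a b (legR k₁ k₂ y) = (o₂ y).map (legR k₁ k₂) := by
  rw [← legEquiv_inr, glueOther_legEquiv, jointOther_inr_of_ne hy]
  cases o₂ y <;> simp

section Laws

variable (ha : o₁ a = none) (hb : o₂ b = none)
include ha hb

/-- kernel: the glued lines have two distinct endpoints, if the old ones do. [cite: Balaban1983Higgs3, p.415] -/
theorem jointOther_ne (h₁ : ∀ x y, o₁ x = some y → y ≠ x) (h₂ : ∀ x y, o₂ x = some y → y ≠ x) :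
    ∀ u w, jointOther o₁ o₂ a b u = some w → w ≠ u := by
  rintro (x | y) w hw
  · by_cases hx : x = a
    · subst hx; simp at hw; subst hw; simp
    · rw [jointOther_inl_of_ne hx] at hw
      obtain ⟨x', hx', rfl⟩ := Option.map_eq_some_iff.1 hw
      simpa using h₁ x x' hx'
  · by_cases hy : y = b
    · subst hy; simp at hw; subst hw; simp
    · rw [jointOther_inr_of_ne hy] at hw
      obtain ⟨y', hy', rfl⟩ := Option.map_eq_some_iff.1 hw
      simpa using h₂ y y' hy'

/-- kernel: the glued "other endpoint" map is symmetric, if the old ones are (uses that `a`, `b` were external).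
[cite: Balaban1983Higgs3, p.415] -/
theorem jointOther_symm (h₁ : ∀ x y, o₁ x = some y → o₁ y = some x) (h₂ : ∀ x y, o₂ x = some y → o₂ y = some x) :
    ∀ u w, jointOther o₁ o₂ a b u = some w → jointOther o₁ o₂ a b w = some u := by
  rintro (x | y) w hw
  · by_cases hx : x = a
    · subst hx; simp at hw; subst hw; simp
    · rw [jointOther_inl_of_ne hx] at hw
      obtain ⟨x', hx', rfl⟩ := Option.map_eq_some_iff.1 hw
      have hx'a : x' ≠ a := by rintro rfl; rw [h₁ x x' hx'] at ha; simp at ha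
      rw [jointOther_inl_of_ne hx'a, h₁ x x' hx']; rfl
  · by_cases hy : y = b
    · subst hy; simp at hw; subst hw; simp
    · rw [jointOther_inr_of_ne hy] at hw
      obtain ⟨y', hy', rfl⟩ := Option.map_eq_some_iff.1 hw
      have hy'b : y' ≠ b := by rintro rfl; rw [h₂ y y' hy'] at hb; simp at hb
      rw [jointOther_inr_of_ne hy'b, h₂ y y' hy']; rfl

omit ha hb in
/-- kernel: the glued lines join legs of one species, if the old ones do and `a`, `b` have the same species.
[cite: Balaban1983Higgs3, p.414] -/
theorem jointOther_isLeft (hab : a.2.isLeft = b.2.isLeft) (h₁ : ∀ x y, o₁ x = some y → x.2.isLeft = y.2.isLeft)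
    (h₂ : ∀ x y, o₂ x = some y → x.2.isLeft = y.2.isLeft) :
    ∀ u w, jointOther o₁ o₂ a b u = some w →
      (Sum.elim (fun x : Leg k₁ => x.2.isLeft) (fun y : Leg k₂ => y.2.isLeft) u) =
        Sum.elim (fun x : Leg k₁ => x.2.isLeft) (fun y : Leg k₂ => y.2.isLeft) w := by
  rintro (x | y) w hw
  · by_cases hx : x = a
    · subst hx; simp at hw; subst hw; simpa using hab
    · rw [jointOther_inl_of_ne hx] at hw
      obtain ⟨x', hx', rfl⟩ := Option.map_eq_some_iff.1 hw
      simpa using h₁ x x' hx'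
  · by_cases hy : y = b
    · subst hy; simp at hw; subst hw; simpa using hab.symm
    · rw [jointOther_inr_of_ne hy] at hw
      obtain ⟨y', hy', rfl⟩ := Option.map_eq_some_iff.1 hw
      simpa using h₂ y y' hy'

end Laws

/-- kernel: the species of a leg of the juxtaposed family, read through `legEquiv`. [cite: Balaban1983Higgs3, (1.17) p.415] -/
theorem isLeft_legEquiv (u : Leg k₁ ⊕ Leg k₂) :
    (legEquiv k₁ k₂ u).2.isLeft = Sum.elim (fun x : Leg k₁ => x.2.isLeft) (fun y : Leg k₂ => y.2.isLeft) u := by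
  cases u
  · exact isLeft_legL _ _ _
  · exact isLeft_legR _ _ _

/-- kernel: a value of `glueOther` unpacked through `legEquiv`. [cite: Balaban1983Higgs3, (1.21) p.416] -/
theorem glueOther_eq_some_iff {z w : Leg (Fin.append k₁ k₂)} :
    glueOther o₁ o₂ a b z = some w ↔
      jointOther o₁ o₂ a b ((legEquiv k₁ k₂).symm z) = some ((legEquiv k₁ k₂).symm w) := by
  unfold glueOther
  constructor
  · intro h
    obtain ⟨u, hu, rfl⟩ := Option.map_eq_some_iff.1 h
    simpa using hu
  · intro h
    rw [h]
    simp only [Option.map_some, Equiv.apply_symm_apply]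

/-- kernel (field law `other_ne` of the glued graph). [cite: Balaban1983Higgs3, p.415] -/
theorem glueOther_ne (ha : o₁ a = none) (hb : o₂ b = none) (h₁ : ∀ x y, o₁ x = some y → y ≠ x)
    (h₂ : ∀ x y, o₂ x = some y → y ≠ x) : ∀ z w, glueOther o₁ o₂ a b z = some w → w ≠ z := by
  intro z w hw hzw
  have := jointOther_ne ha hb h₁ h₂ _ _ (glueOther_eq_some_iff.1 hw)
  exact this (by rw [hzw])

/-- kernel (field law `other_symm` of the glued graph). [cite: Balaban1983Higgs3, p.415] -/
theorem glueOther_symm (ha : o₁ a = none) (hb : o₂ b = none) (h₁ : ∀ x y, o₁ x = some y → o₁ y = some x)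
    (h₂ : ∀ x y, o₂ x = some y → o₂ y = some x) :
    ∀ z w, glueOther o₁ o₂ a b z = some w → glueOther o₁ o₂ a b w = some z := by
  intro z w hw
  exact glueOther_eq_some_iff.2 (jointOther_symm ha hb h₁ h₂ _ _ (glueOther_eq_some_iff.1 hw))

/-- kernel (field law `other_isLeft` of the glued graph). [cite: Balaban1983Higgs3, p.414] -/
theorem glueOther_isLeft (hab : a.2.isLeft = b.2.isLeft) (h₁ : ∀ x y, o₁ x = some y → x.2.isLeft = y.2.isLeft)
    (h₂ : ∀ x y, o₂ x = some y → x.2.isLeft = y.2.isLeft) :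
    ∀ z w, glueOther o₁ o₂ a b z = some w → z.2.isLeft = w.2.isLeft := by
  intro z w hw
  have h := jointOther_isLeft hab h₁ h₂ _ _ (glueOther_eq_some_iff.1 hw)
  rwa [← isLeft_legEquiv, ← isLeft_legEquiv, Equiv.apply_symm_apply, Equiv.apply_symm_apply] at h

end LineData

end Literature.MathematicalPhysics.QuantumFieldTheory.Balaban1983to89.B3GraphGlueLegs
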